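import Summits.AtomisticToContinuum.BoseEinsteinCondensation.Theses.BECModePrice
import Literature.MathematicalPhysics.QuantumManyBody.PeriodicBoseGasFracEnergy
import Literature.MathematicalPhysics.QuantumManyBody.HardCoreScatteringLength
import Literature.MathematicalPhysics.QuantumManyBody.LiebYngvasonTheorem
import Literature.Barriers.AtomisticToContinuum.KineticGapLengthScalesThermodynamicWindow
import HarnessLib

/-!
# Negative lemmas for crux `ModePriceHardCore` (stmt-AtomisticToContinuum-18513) — I: the mode-summed
# strengthening is false

Supports (does not close) stmt-AtomisticToContinuum-18513, route `BECModePrice` (rank 3):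
`ModePriceHardCore` — single-mode softening (SMS) for non-integrable admissible potentials,
`E₀^per + ½|2πp/L|² n_p(Ψ) ≤ ⟨Ψ, HΨ⟩ + Cρ` for ONE mode `p ≠ 0` at a time. Landed copy of §B1 of the
cdisprove seat's standing file `Cruxes/ModePriceHardCore/Disproof.lean` (cycle 1); `sorry`-free, axioms
`propext` / `Classical.choice` / `Quot.sound`. No Theses statement is asserted; no new definition.

* `lintegral_hardCorePotential_one_eq_top` — the unit hard core is non-integrable (the crux's class is
  inhabited: with `isRepulsiveFiniteRange_hardCorePotential` the hypotheses are satisfiable).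
* `periodicEnergy_hardCore_eq_kinetic` — a finite-energy periodic trial state of the hard-sphere gas is
  PURELY KINETIC: `E(Ψ) = ∫_cell |∇Ψ|²` (the interaction integrand is `{0,⊤}`-valued, so `2·I = I`).
* `not_allModePrice` — **the MODE-SUMMED strengthening of the crux is false**: summing the single-mode
  inequality over all modes gives `E₀^per + ½T(Ψ) ≤ E(Ψ) + Cρ` (Parseval
  `∑_p|k_p|²n_p = T`, `tsum_fracDispersion_two_mul_cellOccupation`); at a `1`-near-minimiser of the
  unit hard core (`E = T < E₀ + 1`) this forces `E₀^per ≤ 1 + 2Cρ`, contradicting the Lieb–Yngvason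
  lower bound `E₀^per(N, L_N) ≥ 4πρ(1 − C Y^{1/17})N ≥ 2πρN` (`LSSY2005_lowerBound_periodic_holds`,
  LSSY Thm 2.4, proved in the tree) for large `N`.

Moral for provers: the SINGLE-mode restriction is load-bearing. The kinetic energy of near-minimisers
is extensive (`≥ E₀^per ∼ 4πρaN`, all of it for hard cores) while the price is `O(ρ)`; so SMS cannot
be obtained from, or summed into, any statement about a family of modes carrying a fixed fraction of
`T` — a proof must use that one mode carries `o(1)·T` in every near-minimiser, which is itself an
(exponent-2 infrared) condensation-type input.

References: LSSY2005 = Lieb–Seiringer–Solovej–Yngvason, *The Mathematics of the Bose Gas and its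
Condensation* (2005), Thm. 2.4 (2.35); §1.2 (1.16)–(1.18) (occupations, Parseval). `[folklore]` otherwise.
-/

noncomputable section

namespace Summit.AtomisticToContinuum.BoseEinsteinCondensation.Theorems.ModePriceHardCore.Negative

open MeasureTheory Filter Metric
open scoped ENNReal NNReal Topology
open Literature.MathematicalPhysics.QuantumManyBody.BoseGas

/-! ## The witness potential -/

/-- `∫_{ℝ³} hardCorePotential 1 (|x|) dx = ⊤` (the unit ball has positive volume). [folklore] -/
theorem lintegral_hardCorePotential_one_eq_top :
    (∫⁻ x : Space, hardCorePotential 1 ‖x‖) = ⊤ := by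
  have hball : ∀ x ∈ ball (0 : Space) 1, hardCorePotential 1 ‖x‖ = ⊤ := by
    intro x hx
    rw [mem_ball_zero_iff] at hx
    exact hardCorePotential_of_lt hx
  have hle : ∫⁻ x in ball (0 : Space) 1, hardCorePotential 1 ‖x‖ ≤ ∫⁻ x : Space, hardCorePotential 1 ‖x‖ :=
    setLIntegral_le_lintegral _ _
  rw [setLIntegral_congr_fun measurableSet_ball hball, setLIntegral_const] at hle
  have hvol : volume (ball (0 : Space) 1) ≠ 0 := (measure_ball_pos volume _ one_pos).ne'
  rw [ENNReal.top_mul hvol] at hle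
  exact top_le_iff.1 hle

/-! ## Finite-energy hard-core states are purely kinetic -/

/-- `2 · hardCorePotential a = hardCorePotential a` (values in `{0, ⊤}`). [folklore] -/
theorem two_mul_hardCorePotential (a r : ℝ) : 2 * hardCorePotential a r = hardCorePotential a r := by
  by_cases h : r < a
  · rw [hardCorePotential_of_lt h, ENNReal.mul_top two_ne_zero]
  · rw [hardCorePotential_of_le (not_lt.1 h), mul_zero]

/-- `2 · V = V` for the periodic hard-core interaction (values in `{0, ⊤}`). [folklore] -/
theorem two_mul_periodicInteraction_hardCore (a L : ℝ) {N : ℕ} (X : Config N) :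
    2 * periodicInteraction (hardCorePotential a) L X = periodicInteraction (hardCorePotential a) L X := by
  unfold periodicInteraction periodizedPotential
  rw [Finset.mul_sum]
  refine Finset.sum_congr rfl fun i _ => ?_
  rw [Finset.mul_sum]
  refine Finset.sum_congr rfl fun j _ => ?_
  rw [← ENNReal.tsum_mul_left]
  exact tsum_congr fun n => two_mul_hardCorePotential a _

/-- In `ℝ≥0∞`, `2x = x` forces `x = 0` or `x = ⊤`. -/
theorem eq_zero_or_top_of_two_mul_eq {x : ℝ≥0∞} (h : 2 * x = x) : x = 0 ∨ x = ⊤ := by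
  by_cases h0 : x = 0
  · exact Or.inl h0
  by_cases ht : x = ⊤
  · exact Or.inr ht
  have h1 : (2 : ℝ≥0∞) * x = 1 * x := by rw [h, one_mul]
  have := (ENNReal.mul_left_inj h0 ht).1 h1
  norm_num at this

/-- **Finite-energy hard-core states are purely kinetic**: `E(Ψ) < ⊤ ⇒ E(Ψ) = T(Ψ) = ∫_cell |∇Ψ|²`
(the interaction integrand is `{0,⊤}`-valued, so its integral is `0` or `⊤`). [folklore] -/
theorem periodicEnergy_hardCore_eq_kinetic {a L : ℝ} {N : ℕ} (Ψ : PeriodicTrialState N L)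
    (hfin : periodicEnergy (hardCorePotential a) Ψ ≠ ⊤) :
    periodicEnergy (hardCorePotential a) Ψ = ∫⁻ X in cellN N L, kineticDensity Ψ.ψ X := by
  set I : ℝ≥0∞ := ∫⁻ X in cellN N L,
    periodicInteraction (hardCorePotential a) L X * (‖Ψ.ψ X‖₊ : ℝ≥0∞) ^ 2 with hI
  have hsplit : periodicEnergy (hardCorePotential a) Ψ = (∫⁻ X in cellN N L, kineticDensity Ψ.ψ X) + I := by
    rw [periodicEnergy, hI, ← lintegral_add_left (measurable_kineticDensity_any Ψ.ψ)]
  have h2I : 2 * I = I := by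
    rw [hI, ← lintegral_const_mul' _ _ ENNReal.ofNat_ne_top]
    refine lintegral_congr fun X => ?_
    rw [← mul_assoc, two_mul_periodicInteraction_hardCore]
  rcases eq_zero_or_top_of_two_mul_eq h2I with h0 | htop
  · rw [hsplit, h0, add_zero]
  · exact absurd (by rw [hsplit, htop, add_top]) hfin

/-! ## The refutation -/

/-- **The mode-summed strengthening of `ModePriceHardCore` is FALSE** (statement spelled out inline:
the crux with `½|2πp/L|²n_p(Ψ)` for one `p ≠ 0` replaced by the sum over all modes
`½∑_p|2πp/L|²n_p(Ψ) = ½T(Ψ)`, same quantifiers). Witness: the unit hard core; at a `1`-near-minimiser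
`E = T`, so the inequality forces `E₀^per ≤ 1 + 2Cρ`, against Lieb–Yngvason `E₀^per ≥ 2πρN`.
[cite: LSSY2005, Thm. 2.4 (2.35)] -/
theorem not_allModePrice :
    ¬ (∀ v : ℝ → ℝ≥0∞, IsRepulsiveFiniteRange v → (∫⁻ x : Space, v ‖x‖) = ⊤ →
        ∃ C : ℝ, 0 < C ∧ ∃ ρ₀ : ℝ, 0 < ρ₀ ∧ ∀ ρ : ℝ, 0 < ρ → ρ < ρ₀ →
          ∀ᶠ N : ℕ in atTop, ∀ Ψ : PeriodicTrialState N (sideLength ρ N),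
            periodicGroundStateEnergy v N (sideLength ρ N)
                + 2⁻¹ * ∑' p : Fin 3 → ℤ, fracDispersion 2 (sideLength ρ N) p
                    * cellOccupation N (sideLength ρ N) (planeWaveMode (sideLength ρ N) p) Ψ.ψ
              ≤ periodicEnergy v Ψ + ENNReal.ofReal (C * ρ)) := by
  intro H
  have hv := isRepulsiveFiniteRange_hardCorePotential (1 : ℝ)
  obtain ⟨C, hC, ρ₀, hρ₀, hmain⟩ := H _ hv lintegral_hardCorePotential_one_eq_top
  -- Lieb–Yngvason lower bound for the unit hard core (`a = 1`)
  have haT : scatteringLength (hardCorePotential (1 : ℝ)) ≠ ⊤ := by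
    rw [scatteringLength_hardCorePotential]; exact ENNReal.ofReal_ne_top
  have ha1 : (scatteringLength (hardCorePotential (1 : ℝ))).toReal = 1 :=
    toReal_scatteringLength_hardCorePotential zero_le_one
  obtain ⟨δ, CL, C', hδ, hCL, hC', hLB⟩ := LSSY2005_lowerBound_periodic_holds _ hv haT
  -- Ruelle finiteness threshold
  obtain ⟨ρ₁, hρ₁, hfinE⟩ :=
    Literature.Barriers.AtomisticToContinuum.BoseGas.exists_eventually_periodicGroundStateEnergy_lt_top hv
  -- the density: below every threshold, and `Y = 4πρ/3` so small that `CL·Y^{1/17} ≤ 1/2`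
  set Ym : ℝ := min (min δ 1) ((1 / (2 * CL)) ^ (17 : ℕ)) with hYm_def
  have hYm : 0 < Ym := lt_min (lt_min hδ one_pos) (by positivity)
  set ρ : ℝ := min (min (ρ₀ / 2) (ρ₁ / 2)) (3 * Ym / (8 * Real.pi)) with hρ_def
  have hρ : 0 < ρ := lt_min (lt_min (by positivity) (by positivity)) (by positivity)
  have hρρ₀ : ρ < ρ₀ := (min_le_left _ _).trans_lt ((min_le_left _ _).trans_lt (by linarith))
  have hρρ₁ : ρ < ρ₁ := (min_le_left _ _).trans_lt ((min_le_right _ _).trans_lt (by linarith))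
  set Y : ℝ := 4 * Real.pi * ρ * 1 ^ 3 / 3 with hY_def
  have hY0 : 0 < Y := by positivity
  have hYlt : Y < Ym := by
    have h1 : ρ ≤ 3 * Ym / (8 * Real.pi) := min_le_right _ _
    have h2 : Y ≤ Ym / 2 := by
      rw [hY_def]
      calc 4 * Real.pi * ρ * 1 ^ 3 / 3 ≤ 4 * Real.pi * (3 * Ym / (8 * Real.pi)) * 1 ^ 3 / 3 := by
            gcongr
        _ = Ym / 2 := by field_simp; ring
    linarith
  have hYδ : Y < δ := hYlt.trans_le ((min_le_left _ _).trans (min_le_left _ _))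
  have hY1 : Y ≤ 1 := (hYlt.trans_le ((min_le_left _ _).trans (min_le_right _ _))).le
  have hYCL : CL * Y ^ ((1 : ℝ) / 17) ≤ 1 / 2 := by
    have h : Y ≤ (1 / (2 * CL)) ^ (17 : ℕ) := (hYlt.trans_le (min_le_right _ _)).le
    have h' : Y ^ ((1 : ℝ) / 17) ≤ 1 / (2 * CL) := by
      have := Real.rpow_le_rpow hY0.le h (by norm_num : (0 : ℝ) ≤ 1 / 17)
      rwa [← Real.rpow_natCast, ← Real.rpow_mul (by positivity), show ((17 : ℕ) : ℝ) * (1 / 17) = 1 by norm_num,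
        Real.rpow_one] at this
    calc CL * Y ^ ((1 : ℝ) / 17) ≤ CL * (1 / (2 * CL)) := mul_le_mul_of_nonneg_left h' hCL.le
      _ = 1 / 2 := by field_simp
  -- eventually in `N`: the summed inequality, finiteness, the LY side condition and `2πρN > 2 + 2Cρ`
  have hLtend := tendsto_sideLength_atTop hρ
  obtain ⟨N, hAll, hfin, hN1, hNL, hNbig⟩ := ((hmain ρ hρ hρρ₀).and ((hfinE ρ hρ hρρ₁).and
    ((eventually_ge_atTop 1).and ((hLtend.eventually_gt_atTop (1 * (C' * Y ^ (-(6 : ℝ) / 17)))).and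
      (eventually_gt_atTop ⌈(2 + 2 * C * ρ) / (2 * Real.pi * ρ)⌉₊))))).exists
  set L := sideLength ρ N with hL_def
  have hN0 : 0 < N := hN1
  have hL : 0 < L := sideLength_pos_of_pos hρ hN0
  have hρL : (N : ℝ) / L ^ 3 = ρ := div_sideLength_pow_three hρ hN0
  -- the lower bound `ofReal (2πρN) ≤ E₀`
  have hLB' := hLB N L hL
  dsimp only at hLB'
  rw [hρL, ha1] at hLB'
  have hcond : C' * Y ^ (-(6 : ℝ) / 17) < L / 1 := by rw [div_one]; linarith
  have hE0lb : ENNReal.ofReal (2 * Real.pi * ρ * N) ≤ periodicGroundStateEnergy (hardCorePotential 1) N L := by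
    refine le_trans (ENNReal.ofReal_le_ofReal ?_) (hLB' hYδ hcond)
    have hN' : (0 : ℝ) ≤ N := Nat.cast_nonneg N
    have h1 : 1 / 2 ≤ 1 - CL * Y ^ ((1 : ℝ) / 17) := by linarith
    calc 2 * Real.pi * ρ * N = 4 * Real.pi * ρ * 1 * (1 / 2) * N := by ring
      _ ≤ 4 * Real.pi * ρ * 1 * (1 - CL * Y ^ ((1 : ℝ) / 17)) * N := by gcongr
  -- a `1`-near-minimiser `Ψ` with finite, purely kinetic energy
  set E₀ := periodicGroundStateEnergy (hardCorePotential 1) N L with hE₀_def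
  have hE₀top : E₀ ≠ ⊤ := hfin.ne
  obtain ⟨Ψ, hΨ⟩ : ∃ Ψ : PeriodicTrialState N L, periodicEnergy (hardCorePotential 1) Ψ < E₀ + 1 :=
    iInf_lt_iff.1 (ENNReal.lt_add_right hE₀top one_ne_zero)
  have hEfin : periodicEnergy (hardCorePotential 1) Ψ ≠ ⊤ := (hΨ.trans_le le_top).ne
  set T := ∫⁻ X in cellN N L, kineticDensity Ψ.ψ X with hT_def
  have hET : periodicEnergy (hardCorePotential 1) Ψ = T := periodicEnergy_hardCore_eq_kinetic Ψ hEfin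
  have hTtop : T ≠ ⊤ := hET ▸ hEfin
  have hPars : (∑' p : Fin 3 → ℤ, fracDispersion 2 L p * cellOccupation N L (planeWaveMode L p) Ψ.ψ) = T :=
    tsum_fracDispersion_two_mul_cellOccupation hL Ψ
  -- the summed inequality at `Ψ`: `E₀ + ½T ≤ T + Cρ`
  have hsum := hAll Ψ
  rw [hPars, hET] at hsum
  -- arithmetic in `ℝ`
  set c : ℝ≥0∞ := ENNReal.ofReal (C * ρ) with hc
  have hctop : c ≠ ⊤ := ENNReal.ofReal_ne_top
  have h1 : E₀.toReal + 2⁻¹ * T.toReal ≤ T.toReal + C * ρ := by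
    have := (ENNReal.toReal_le_toReal (by finiteness) (by finiteness)).2 hsum
    rwa [ENNReal.toReal_add hE₀top (by finiteness), ENNReal.toReal_add hTtop hctop,
      ENNReal.toReal_mul, ENNReal.toReal_inv, ENNReal.toReal_ofReal (by positivity)] at this
  have h2 : T.toReal < E₀.toReal + 1 := by
    have := (ENNReal.toReal_lt_toReal hTtop (by finiteness)).2 (hET ▸ hΨ)
    rwa [ENNReal.toReal_add hE₀top ENNReal.one_ne_top, ENNReal.toReal_one] at this
  have h3 : 2 * Real.pi * ρ * N ≤ E₀.toReal := by
    have := (ENNReal.ofReal_le_iff_le_toReal hE₀top).1 hE0lb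
    exact this
  have h4 : (⌈(2 + 2 * C * ρ) / (2 * Real.pi * ρ)⌉₊ : ℝ) < N := by exact_mod_cast hNbig
  have h5 : (2 + 2 * C * ρ) / (2 * Real.pi * ρ) < N := (Nat.le_ceil _).trans_lt h4
  have h6 : 2 + 2 * C * ρ < 2 * Real.pi * ρ * N := by
    rw [div_lt_iff₀ (by positivity)] at h5; linarith
  norm_num at h1
  nlinarith

end Summit.AtomisticToContinuum.BoseEinsteinCondensation.Theorems.ModePriceHardCore.Negative

end
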